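import Literature.Probability.RandomPlanarGeometry.SAWTriangularPolygonUnrooting
import HarnessLib

/-!
# «Tall third» for triangular-lattice polygons: at least `q_N(𝕋)/3` of the `N`-gon classes have `√N` distinct rows
# (stub S1 of a Madras-type `√N`-gain join on `𝕋`; the 3-fold rotation replaces the `x ↔ y` symmetry of `ℤ²`)

Topic `Literature/Probability/RandomPlanarGeometry` (lane «pcv-sawmu», a-p4 g9, successor material for the line «TRI-MADRAS»
(`q_N(𝕋) ≤ A N^{−1/2} μ(𝕋)^N`); continues `SAWTriangularPolygonUnrooting.lean`: canonical traversals `TriPolygon.triPolygonReps n`, closing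
walks `loops n`, re-rootings `rotF`/`rotB`/`unroot`, `unroot_injOn`, `loops_subset_image`).

Source of the scheme: N. Madras, *A rigorous bound on the critical exponent for the number of lattice trees, animals, and polygons*,
J. Stat. Phys. 78 (1995) 681–699, §2 (primary; not held by the lane — on `ℤ²`: at least half of the polygons are at least as tall as wide, by
the symmetry exchanging the coordinates; a tall polygon through `N` sites occupies at least `√N` rows — here `sq_rowCount_ge`; printed in the secondary source A. Hammond, arXiv:1504.05286v5
§3.4 p. 12: "Orient φ and φ′ so that the height of each is at least its width; thus each height is at least of order n^ν") — tree `SAWTallPolygons.lean` / `SAWPolygonTall.lean` (`TallHalf`, `TallHeight`).  On the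
triangular lattice (brick frame `brickGraph`: steps `(±2,0)`, `(±1,±1)`) there is no coordinate swap; instead the rotation by `60°`,
`ρ(X, Y) = ((X − 3Y)/2, (X + Y)/2)` on the even sublattice, permutes the three axial coordinates `Y`, `(X+Y)/2`, `(X−Y)/2` cyclically, so
at least a THIRD of the classes have their largest axial extent along `Y` (rows), and that extent is `≥ √(N)` since the `N` sites are
determined by two axial coordinates.

## What is proved (namespace `…SAW.TriPolygon`; all `theorem`s, axioms standard)

* `rowCount`, `sumCount`, `difCount` (numbers of distinct values of `Y`, `X+Y`, `X−Y` along `ω` on `[0,n]`),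
  `succ_le_rowCount_mul_sumCount` etc. (`n+1 ≤ e_Y·e_S`, `≤ e_S·e_D`, `≤ e_D·e_Y`);
* the rotation `rot60`, `adj_rot60`, `rotW_mem_loops`, the class map `rotClass : triPolygonReps n → triPolygonReps n` (rotate, then
  re-root canonically) and `rotClass_injOn`; the axial counts of `rotClass ω` are those of `ω` cyclically permuted (`counts_rotClass`);
* **`card_reps_le_three_mul_tall : #Q[n+1] ≤ 3 · #{ω ∈ Q[n+1] : IsYTall n ω}`** (`IsYTall`: `sumCount ≤ rowCount ∧ difCount ≤ rowCount`)
  and **`sq_rowCount_ge : n + 1 ≤ (rowCount ω)²`** for such `ω` (Madras' S1 on `𝕋`).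

Printed anchors (label lit-2 g16, 2026-08-23: CONSOLIDATION-BY-TRANSFER — 𝕋 edition: one third, by the 3-fold rotation):
[cite: Hammond2015SAPJoining, Definition 4.8 and Lemma 4.9 (arXiv v5 pp. 24–25: h(φ) ≥ w(φ) for at least half of SAP_n, by right-angled
rotation; h(φ) ≥ n^{1/2})] [cite: Madras1995LatticeAnimalsExponent, §2 (primary; not held by the lane)].
-/

noncomputable section

open Finset Function Literature.Probability.LatticeModels Literature.Probability.Percolation SimpleGraph

namespace Literature.Probability.RandomPlanarGeometry.SAW

namespace TriPolygon

/-! ### Axial counts -/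

section Axial

variable {n : ℕ} {ω : ℕ → Site 2}

open Classical in
/-- Number of distinct rows `Y` visited on `[0,n]`. [cite: Madras1995LatticeAnimalsExponent, §2 (height of a polygon)] -/
def rowCount (n : ℕ) (ω : ℕ → Site 2) : ℕ := #((range (n + 1)).image fun i => ω i 1)

open Classical in
/-- Number of distinct values of `X + Y` visited on `[0,n]` (the second axial coordinate). [cite: Madras1995LatticeAnimalsExponent, §2 (width of a polygon)] -/
def sumCount (n : ℕ) (ω : ℕ → Site 2) : ℕ := #((range (n + 1)).image fun i => ω i 0 + ω i 1)

open Classical in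
/-- Number of distinct values of `X − Y` visited on `[0,n]` (the third axial coordinate). [cite: Madras1995LatticeAnimalsExponent, §2 (width of a polygon)] -/
def difCount (n : ℕ) (ω : ℕ → Site 2) : ℕ := #((range (n + 1)).image fun i => ω i 0 - ω i 1)

/-- Two axial coordinates determine the site: `n + 1 ≤ e_Y · e_S` for a walk injective on `[0,n]`.
[cite: Madras1995LatticeAnimalsExponent, §2 (the sites lie in a box; primary, not held by the lane); Hammond2015SAPJoining, Definition 4.8 (arXiv v5 p. 24: "h(φ) ≥ w(φ) (and thus, by a trivial argument, h(φ) ≥ n^{1/2})")] -/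
theorem succ_le_rowCount_mul_sumCount (hinj : Set.InjOn ω {i | i ≤ n}) : n + 1 ≤ rowCount n ω * sumCount n ω := by
  classical
  unfold rowCount sumCount
  rw [← Finset.card_product]
  calc n + 1 = #(range (n + 1)) := (Finset.card_range _).symm
    _ ≤ _ := Finset.card_le_card_of_injOn (fun i => (ω i 1, ω i 0 + ω i 1)) (fun i hi => ?_) (fun i hi j hj h => ?_)
  · rw [Finset.mem_coe] at hi
    rw [Finset.mem_coe, Finset.mem_product]
    exact ⟨Finset.mem_image.2 ⟨i, hi, rfl⟩, Finset.mem_image.2 ⟨i, hi, rfl⟩⟩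
  · rw [Finset.mem_coe, Finset.mem_range] at hi hj
    simp only [Prod.mk.injEq] at h
    refine hinj (show i ∈ {i | i ≤ n} by simp; omega) (show j ∈ {i | i ≤ n} by simp; omega) ?_
    funext k; fin_cases k
    · show ω i 0 = ω j 0; omega
    · exact h.1

/-- `n + 1 ≤ e_S · e_D`. [cite: Madras1995LatticeAnimalsExponent, §2] -/
theorem succ_le_sumCount_mul_difCount (hinj : Set.InjOn ω {i | i ≤ n}) : n + 1 ≤ sumCount n ω * difCount n ω := by
  classical
  unfold sumCount difCount
  rw [← Finset.card_product]
  calc n + 1 = #(range (n + 1)) := (Finset.card_range _).symm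
    _ ≤ _ := Finset.card_le_card_of_injOn (fun i => (ω i 0 + ω i 1, ω i 0 - ω i 1)) (fun i hi => ?_) (fun i hi j hj h => ?_)
  · rw [Finset.mem_coe] at hi
    rw [Finset.mem_coe, Finset.mem_product]
    exact ⟨Finset.mem_image.2 ⟨i, hi, rfl⟩, Finset.mem_image.2 ⟨i, hi, rfl⟩⟩
  · rw [Finset.mem_coe, Finset.mem_range] at hi hj
    simp only [Prod.mk.injEq] at h
    refine hinj (show i ∈ {i | i ≤ n} by simp; omega) (show j ∈ {i | i ≤ n} by simp; omega) ?_
    funext k; fin_cases k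
    · show ω i 0 = ω j 0; omega
    · show ω i 1 = ω j 1; omega

/-- `n + 1 ≤ e_D · e_Y`. [cite: Madras1995LatticeAnimalsExponent, §2] -/
theorem succ_le_difCount_mul_rowCount (hinj : Set.InjOn ω {i | i ≤ n}) : n + 1 ≤ difCount n ω * rowCount n ω := by
  classical
  unfold difCount rowCount
  rw [← Finset.card_product]
  calc n + 1 = #(range (n + 1)) := (Finset.card_range _).symm
    _ ≤ _ := Finset.card_le_card_of_injOn (fun i => (ω i 0 - ω i 1, ω i 1)) (fun i hi => ?_) (fun i hi j hj h => ?_)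
  · rw [Finset.mem_coe] at hi
    rw [Finset.mem_coe, Finset.mem_product]
    exact ⟨Finset.mem_image.2 ⟨i, hi, rfl⟩, Finset.mem_image.2 ⟨i, hi, rfl⟩⟩
  · rw [Finset.mem_coe, Finset.mem_range] at hi hj
    simp only [Prod.mk.injEq] at h
    refine hinj (show i ∈ {i | i ≤ n} by simp; omega) (show j ∈ {i | i ≤ n} by simp; omega) ?_
    funext k; fin_cases k
    · show ω i 0 = ω j 0; omega
    · exact h.2

/-- The axial counts are invariant under translation of the walk. [folklore] -/
private theorem counts_sub_const (t : Site 2) :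
    rowCount n (fun i => ω i - t) = rowCount n ω ∧ sumCount n (fun i => ω i - t) = sumCount n ω ∧
      difCount n (fun i => ω i - t) = difCount n ω := by
  classical
  unfold rowCount sumCount difCount
  refine ⟨?_, ?_, ?_⟩
  · rw [show (fun i => (ω i - t) 1) = (fun y => y - t 1) ∘ (fun i => ω i 1) by funext i; simp, ← Finset.image_image]
    exact Finset.card_image_of_injective _ (sub_left_injective)
  · rw [show (fun i => (ω i - t) 0 + (ω i - t) 1) = (fun y => y - (t 0 + t 1)) ∘ (fun i => ω i 0 + ω i 1) by
      funext i; simp; ring, ← Finset.image_image]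
    exact Finset.card_image_of_injective _ (sub_left_injective)
  · rw [show (fun i => (ω i - t) 0 - (ω i - t) 1) = (fun y => y - (t 0 - t 1)) ∘ (fun i => ω i 0 - ω i 1) by
      funext i; simp; ring, ← Finset.image_image]
    exact Finset.card_image_of_injective _ (sub_left_injective)

end Axial

/-! ### The even sublattice and the rotation by `60°` -/

section Rot

variable {n : ℕ} {ω : ℕ → Site 2}

/-- Brick walks from `0` live on the even sublattice `X + Y ≡ 0 (mod 2)`. [cite: Grimmett2018, §5.5 (brick coordinates of 𝕋)] -/
theorem even_of_mem_brickSaws (hω : ω ∈ brickSaws n) (i : ℕ) : (ω i 0 + ω i 1) % 2 = 0 := by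
  obtain ⟨h0, hfr, hadj, -⟩ := mem_brickSaws.1 hω
  have key : ∀ i, i ≤ n → (ω i 0 + ω i 1) % 2 = 0 := by
    intro i
    induction i with
    | zero => intro _; rw [h0]; simp
    | succ k ih =>
      intro hk
      have h := hadj k (by omega)
      rw [brickGraph_adj_iff] at h
      have := ih (by omega)
      omega
  rcases le_or_gt i n with hi | hi
  · exact key i hi
  · rw [hfr i hi.le]; exact key n le_rfl

/-- The rotation by `60°` in brick coordinates: `(X, Y) ↦ ((X − 3Y)/2, (X + Y)/2)` (exact on the even sublattice).
[cite: Grimmett2018, §5.5 (brick coordinates of 𝕋)] -/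
def rot60 (z : Site 2) : Site 2 := ![(z 0 - 3 * z 1) / 2, (z 0 + z 1) / 2]

/-- The rotation by `−60°`: `(X, Y) ↦ ((X + 3Y)/2, (Y − X)/2)`. [cite: Grimmett2018, §5.5 (brick coordinates of 𝕋)] -/
def rot300 (z : Site 2) : Site 2 := ![(z 0 + 3 * z 1) / 2, (z 1 - z 0) / 2]

/-- coordinates of `rot60`. [folklore] -/
@[simp] private theorem rot60_zero (z : Site 2) : rot60 z 0 = (z 0 - 3 * z 1) / 2 := rfl
/-- coordinates of `rot60`. [folklore] -/
@[simp] private theorem rot60_one (z : Site 2) : rot60 z 1 = (z 0 + z 1) / 2 := rfl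
/-- coordinates of `rot300`. [folklore] -/
@[simp] private theorem rot300_zero (z : Site 2) : rot300 z 0 = (z 0 + 3 * z 1) / 2 := rfl
/-- coordinates of `rot300`. [folklore] -/
@[simp] private theorem rot300_one (z : Site 2) : rot300 z 1 = (z 1 - z 0) / 2 := rfl

/-- Two sites of `ℤ²` agree iff both coordinates do. [folklore] -/
private theorem site_eq_iff' {x y : Site 2} : x = y ↔ x 0 = y 0 ∧ x 1 = y 1 := by
  constructor
  · rintro rfl; exact ⟨rfl, rfl⟩
  · rintro ⟨h0, h1⟩; funext i; fin_cases i <;> assumption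

/-- `rot300 ∘ rot60 = id` on the even sublattice. [folklore] -/
private theorem rot300_rot60 {z : Site 2} (hz : (z 0 + z 1) % 2 = 0) : rot300 (rot60 z) = z := by
  rw [site_eq_iff']; simp only [rot300_zero, rot300_one, rot60_zero, rot60_one]; omega

/-- `rot60` preserves the even sublattice. [folklore] -/
private theorem even_rot60 {z : Site 2} (hz : (z 0 + z 1) % 2 = 0) : (rot60 z 0 + rot60 z 1) % 2 = 0 := by
  simp only [rot60_zero, rot60_one]; omega

/-- `rot60 0 = 0`. [folklore] -/
private theorem rot60_zero' : rot60 0 = 0 := by rw [site_eq_iff']; simp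

/-- `rot60` is additive against subtraction on the even sublattice. [folklore] -/
private theorem rot60_sub {x y : Site 2} (hx : (x 0 + x 1) % 2 = 0) (hy : (y 0 + y 1) % 2 = 0) :
    rot60 (x - y) = rot60 x - rot60 y := by
  rw [site_eq_iff']; simp only [rot60_zero, rot60_one, Pi.sub_apply]; omega

/-- `rot300` likewise. [folklore] -/
private theorem rot300_sub {x y : Site 2} (hx : (x 0 + x 1) % 2 = 0) (hy : (y 0 + y 1) % 2 = 0) :
    rot300 (x - y) = rot300 x - rot300 y := by
  rw [site_eq_iff']; simp only [rot300_zero, rot300_one, Pi.sub_apply]; omega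

/-- **`rot60` is an automorphism of the brick graph** (on the even sublattice): it permutes the six steps `±A ↦ ±B ↦ ∓C ↦ ±A`.
[cite: Grimmett2018, §5.5 (brick coordinates of 𝕋)] -/
theorem adj_rot60 {x y : Site 2} (hx : (x 0 + x 1) % 2 = 0) (h : brickGraph.Adj x y) : brickGraph.Adj (rot60 x) (rot60 y) := by
  rw [brickGraph_adj_iff] at h ⊢
  simp only [rot60_zero, rot60_one]
  omega

/-- The rotated walk. [cite: MadrasSlade1993, §3.2 (proof of Theorem 3.2.3: "by symmetry")] -/
def rotW (ω : ℕ → Site 2) : ℕ → Site 2 := fun i => rot60 (ω i)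

/-- **The rotated closing walk is a closing walk.** [cite: MadrasSlade1993, §3.2 (proof of Theorem 3.2.3: "by symmetry")] -/
theorem rotW_mem_loops (hω : ω ∈ loops n) : rotW ω ∈ loops n := by
  obtain ⟨hs, hc⟩ := mem_loops.1 hω
  have hev := even_of_mem_brickSaws hs
  obtain ⟨h0, hfr, hadj, hinj⟩ := mem_brickSaws.1 hs
  refine mem_loops.2 ⟨mem_brickSaws.2 ⟨?_, fun i hi => ?_, fun i hi => ?_, fun i hi j hj hij => ?_⟩, ?_⟩
  · simp only [rotW, h0]; exact rot60_zero'
  · simp only [rotW, hfr i hi]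
  · exact adj_rot60 (hev i) (hadj i hi)
  · have h := congrArg rot300 hij
    simp only [rotW, rot300_rot60 (hev i), rot300_rot60 (hev j)] at h
    exact hinj hi hj h
  · have h := adj_rot60 (hev n) hc
    rwa [rot60_zero'] at h

end Rot

/-! ### Re-rooting bookkeeping (local copies of the parent's private lemmas) and the class map of the rotation -/

section Canon

variable {n : ℕ} {ω υ ζ W : ℕ → Site 2}

/-- `addc` stays in `[0,n]`. [folklore] -/
private theorem addc_le' {r i : ℕ} (hr : r ≤ n) (hi : i ≤ n) : addc n r i ≤ n := by unfold addc; split_ifs <;> omega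
/-- `subc` stays in `[0,n]`. [folklore] -/
private theorem subc_le' {r i : ℕ} (hr : r ≤ n) (hi : i ≤ n) : subc n r i ≤ n := by unfold subc; split_ifs <;> omega

/-- `rotF ρ 0 = ρ` for a walk frozen after `n` and starting at `0`. [folklore] -/
private theorem rotF_zero_self' (hρ : ω ∈ brickSaws n) : rotF n ω 0 = ω := by
  obtain ⟨h0, hfr, -, -⟩ := mem_brickSaws.1 hρ
  funext i
  simp only [rotF, h0, sub_zero, addc, zero_add]
  rcases le_or_gt i n with hi | hi
  · rw [min_eq_left hi, if_pos hi]
  · rw [min_eq_right hi.le, if_pos le_rfl, hfr i hi.le]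

/-- Composition `rotF ∘ rotF`. [folklore] -/
private theorem rotF_rotF' {r s : ℕ} (hr : r ≤ n) (hs : s ≤ n) : rotF n (rotF n ω r) s = rotF n ω (addc n r s) := by
  funext i
  have hm : min i n ≤ n := min_le_right _ _
  simp only [rotF, min_eq_left hs, min_eq_left (addc_le' hs hm)]
  rw [show ω (addc n r (addc n s (min i n))) - ω r - (ω (addc n r s) - ω r) =
    ω (addc n r (addc n s (min i n))) - ω (addc n r s) by abel]
  congr 2; unfold addc; split_ifs <;> omega

/-- Composition `rotF ∘ rotB`. [folklore] -/
private theorem rotF_rotB' {r s : ℕ} (hr : r ≤ n) (hs : s ≤ n) : rotF n (rotB n ω r) s = rotB n ω (subc n r s) := by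
  funext i
  have hm : min i n ≤ n := min_le_right _ _
  simp only [rotF, rotB, min_eq_left hs, min_eq_left (addc_le' hs hm)]
  rw [show ω (subc n r (addc n s (min i n))) - ω r - (ω (subc n r s) - ω r) =
    ω (subc n r (addc n s (min i n))) - ω (subc n r s) by abel]
  congr 2; unfold addc subc; split_ifs <;> omega

/-- Composition `rotB ∘ rotF`. [folklore] -/
private theorem rotB_rotF' {r s : ℕ} (hr : r ≤ n) (hs : s ≤ n) : rotB n (rotF n ω r) s = rotB n ω (addc n r s) := by
  funext i
  have hm : min i n ≤ n := min_le_right _ _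
  simp only [rotF, rotB, min_eq_left hs, min_eq_left (subc_le' hs hm)]
  rw [show ω (addc n r (subc n s (min i n))) - ω r - (ω (addc n r s) - ω r) =
    ω (addc n r (subc n s (min i n))) - ω (addc n r s) by abel]
  congr 2; unfold addc subc; split_ifs <;> omega

/-- Composition `rotB ∘ rotB`. [folklore] -/
private theorem rotB_rotB' {r s : ℕ} (hr : r ≤ n) (hs : s ≤ n) : rotB n (rotB n ω r) s = rotF n ω (subc n r s) := by
  funext i
  have hm : min i n ≤ n := min_le_right _ _
  simp only [rotF, rotB, min_eq_left hs, min_eq_left (subc_le' hs hm)]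
  rw [show ω (subc n r (subc n s (min i n))) - ω r - (ω (subc n r s) - ω r) =
    ω (subc n r (subc n s (min i n))) - ω (subc n r s) by abel]
  congr 2; unfold addc subc; split_ifs <;> omega

/-- **Re-rooting twice is re-rooting once.** [cite: MadrasSlade1993, §3.2, eq. (3.2.1) (the `2N` rooted traversals of one class)] -/
theorem unroot_unroot {r₀ r : ℕ} (hr₀ : r₀ ≤ n) (hr : r ≤ n) (b₀ b : Bool) :
    ∃ r₁, r₁ ≤ n ∧ ∃ b₁ : Bool, unroot n (unroot n (ζ, r₀, b₀), r, b) = unroot n (ζ, r₁, b₁) := by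
  unfold unroot
  cases b₀ <;> cases b <;> simp only [Bool.false_eq_true, if_false, if_true]
  · exact ⟨addc n r₀ r, addc_le' hr₀ hr, false, by simp only [Bool.false_eq_true, if_false]; exact rotF_rotF' hr₀ hr⟩
  · exact ⟨addc n r₀ r, addc_le' hr₀ hr, true, by simp only [if_true]; exact rotB_rotF' hr₀ hr⟩
  · exact ⟨subc n r₀ r, subc_le' hr₀ hr, true, by simp only [if_true]; exact rotF_rotB' hr₀ hr⟩
  · exact ⟨subc n r₀ r, subc_le' hr₀ hr, false, by simp only [Bool.false_eq_true, if_false]; exact rotB_rotB' hr₀ hr⟩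

/-- **A canonical traversal that is a re-rooting of another canonical traversal equals it.**
[cite: MadrasSlade1993, §3.2 (proof of Theorem 3.2.3: "`Q[N]` has exactly `q_N` members")] -/
theorem eq_of_unroot_eq (hn : 2 ≤ n) (hω : ω ∈ triPolygonReps n) (hζ : ζ ∈ triPolygonReps n) {r : ℕ} (hr : r ≤ n) {b : Bool}
    (h : unroot n (ζ, r, b) = ω) : ζ = ω := by
  classical
  have hω0 : unroot n (ω, 0, false) = ω := by
    unfold unroot; simp only [Bool.false_eq_true, if_false]; exact rotF_zero_self' (mem_triPolygonReps.1 hω).1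
  have m1 : ((ζ, r, b) : (ℕ → Site 2) × ℕ × Bool) ∈ (↑(triPolygonReps n ×ˢ (range (n + 1) ×ˢ (univ : Finset Bool))) :
      Set ((ℕ → Site 2) × ℕ × Bool)) :=
    Finset.mem_coe.2 (Finset.mem_product.2 ⟨hζ, Finset.mem_product.2 ⟨Finset.mem_range.2 (show r < n + 1 by omega), Finset.mem_univ _⟩⟩)
  have m2 : ((ω, 0, false) : (ℕ → Site 2) × ℕ × Bool) ∈ (↑(triPolygonReps n ×ˢ (range (n + 1) ×ˢ (univ : Finset Bool))) :
      Set ((ℕ → Site 2) × ℕ × Bool)) :=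
    Finset.mem_coe.2 (Finset.mem_product.2 ⟨hω, Finset.mem_product.2 ⟨Finset.mem_range.2 (show 0 < n + 1 by omega), Finset.mem_univ _⟩⟩)
  have key := unroot_injOn hn m1 m2 (h.trans hω0.symm)
  exact (Prod.mk.inj key).1

/-- Every closing walk is a re-rooting of a canonical traversal (`n ≥ 2`), unpacked. [cite: MadrasSlade1993, §3.2, eq. (3.2.1)] -/
theorem exists_canon (hn : 2 ≤ n) (hW : W ∈ loops n) :
    ∃ ζ, ζ ∈ triPolygonReps n ∧ ∃ r, r ≤ n ∧ ∃ b : Bool, unroot n (ζ, r, b) = W := by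
  classical
  have h := loops_subset_image hn hW
  rw [Finset.mem_image] at h
  obtain ⟨⟨ζ, r, b⟩, hx, hxW⟩ := h
  simp only [Finset.mem_product, Finset.mem_range, Nat.lt_succ_iff, Finset.mem_univ, and_true] at hx
  exact ⟨ζ, hx.1, r, hx.2, b, hxW⟩

open Classical in
/-- The canonical traversal of the class of a closing walk. [cite: MadrasSlade1993, Definition 3.2.2 and §3.2 (`Q[N]`)] -/
def canonOf (n : ℕ) (W : ℕ → Site 2) : ℕ → Site 2 :=
  if h : ∃ ζ, ζ ∈ triPolygonReps n ∧ ∃ r, r ≤ n ∧ ∃ b : Bool, unroot n (ζ, r, b) = W then Classical.choose h else W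

/-- Specification of `canonOf`. [cite: MadrasSlade1993, Definition 3.2.2] -/
theorem canonOf_spec (hn : 2 ≤ n) (hW : W ∈ loops n) :
    canonOf n W ∈ triPolygonReps n ∧ ∃ r, r ≤ n ∧ ∃ b : Bool, unroot n (canonOf n W, r, b) = W := by
  classical
  have h := exists_canon hn hW
  unfold canonOf; rw [dif_pos h]
  exact Classical.choose_spec h

/-- The inverse-rotated walk. [cite: MadrasSlade1993, §3.2 (proof of Theorem 3.2.3: "by symmetry")] -/
def rot300W (ω : ℕ → Site 2) : ℕ → Site 2 := fun i => rot300 (ω i)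

/-- `rot300` is an automorphism of the brick graph on the even sublattice. [cite: Grimmett2018, §5.5] -/
theorem adj_rot300 {x y : Site 2} (hx : (x 0 + x 1) % 2 = 0) (h : brickGraph.Adj x y) :
    brickGraph.Adj (rot300 x) (rot300 y) := by
  rw [brickGraph_adj_iff] at h ⊢
  simp only [rot300_zero, rot300_one]
  omega

/-- `rot60 ∘ rot300 = id` on the even sublattice. [folklore] -/
private theorem rot60_rot300 {z : Site 2} (hz : (z 0 + z 1) % 2 = 0) : rot60 (rot300 z) = z := by
  rw [site_eq_iff']; simp only [rot300_zero, rot300_one, rot60_zero, rot60_one]; omega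

/-- The inverse-rotated closing walk is a closing walk. [cite: MadrasSlade1993, §3.2 (proof of Theorem 3.2.3: "by symmetry")] -/
theorem rot300W_mem_loops (hω : ω ∈ loops n) : rot300W ω ∈ loops n := by
  obtain ⟨hs, hc⟩ := mem_loops.1 hω
  have hev := even_of_mem_brickSaws hs
  obtain ⟨h0, hfr, hadj, hinj⟩ := mem_brickSaws.1 hs
  refine mem_loops.2 ⟨mem_brickSaws.2 ⟨?_, fun i hi => ?_, fun i hi => ?_, fun i hi j hj hij => ?_⟩, ?_⟩
  · simp only [rot300W, h0]; rw [site_eq_iff']; simp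
  · simp only [rot300W, hfr i hi]
  · exact adj_rot300 (hev i) (hadj i hi)
  · have h := congrArg rot60 hij
    simp only [rot300W, rot60_rot300 (hev i), rot60_rot300 (hev j)] at h
    exact hinj hi hj h
  · have h := adj_rot300 (hev n) hc
    have h00 : rot300 0 = 0 := by rw [site_eq_iff']; simp
    rwa [h00] at h

/-- `rot300W ∘ rotW = id` on brick walks. [folklore] -/
private theorem rot300W_rotW (hω : ω ∈ brickSaws n) : rot300W (rotW ω) = ω := by
  funext i; exact rot300_rot60 (even_of_mem_brickSaws hω i)

/-- The inverse rotation commutes with re-rooting (linearity on the even sublattice). [folklore] -/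
private theorem rot300W_unroot (hυ : υ ∈ brickSaws n) (r : ℕ) (b : Bool) :
    rot300W (unroot n (υ, r, b)) = unroot n (rot300W υ, r, b) := by
  have hev := even_of_mem_brickSaws hυ
  funext i
  unfold unroot rot300W
  cases b <;> simp only [Bool.false_eq_true, if_false, if_true, rotF, rotB] <;> exact rot300_sub (hev _) (hev _)

/-- **The class map of the rotation**: rotate, then take the canonical traversal of the class.
[cite: MadrasSlade1993, §3.2 (proof of Theorem 3.2.3: "by symmetry")] -/
def rotClass (n : ℕ) (ω : ℕ → Site 2) : ℕ → Site 2 := canonOf n (rotW ω)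

/-- `rotClass` maps `Q[n+1]` to `Q[n+1]`. [cite: MadrasSlade1993, §3.2 (proof of Theorem 3.2.3: "by symmetry")] -/
theorem rotClass_mem (hω : ω ∈ triPolygonReps n) : rotClass n ω ∈ triPolygonReps n := by
  have hn := two_le_of_mem_reps hω
  obtain ⟨hs, hc, -, -⟩ := mem_triPolygonReps.1 hω
  exact (canonOf_spec hn (rotW_mem_loops (mem_loops.2 ⟨hs, hc⟩))).1

/-- **`rotClass` is injective on `Q[n+1]`.** [cite: MadrasSlade1993, §3.2 (proof of Theorem 3.2.3: "by symmetry")] -/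
theorem rotClass_injOn : Set.InjOn (rotClass n) ↑(triPolygonReps n) := by
  intro ω hω ω' hω' h
  rw [Finset.mem_coe] at hω hω'
  have hn := two_le_of_mem_reps hω
  -- unpack both canonicalisations of the common value
  have hl : rotW ω ∈ loops n :=
    rotW_mem_loops (mem_loops.2 ⟨(mem_triPolygonReps.1 hω).1, (mem_triPolygonReps.1 hω).2.1⟩)
  have hl' : rotW ω' ∈ loops n :=
    rotW_mem_loops (mem_loops.2 ⟨(mem_triPolygonReps.1 hω').1, (mem_triPolygonReps.1 hω').2.1⟩)
  obtain ⟨hυ, r, hr, b, hub⟩ := canonOf_spec hn hl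
  obtain ⟨-, r', hr', b', hub'⟩ := canonOf_spec hn hl'
  unfold rotClass at h
  rw [← h] at hub'
  set υ := canonOf n (rotW ω) with hυdef
  have hυs := (mem_triPolygonReps.1 hυ).1
  -- pull back by the inverse rotation
  have hζl : rot300W υ ∈ loops n := rot300W_mem_loops (mem_loops.2 ⟨hυs, (mem_triPolygonReps.1 hυ).2.1⟩)
  have e1 : unroot n (rot300W υ, r, b) = ω := by
    rw [← rot300W_unroot hυs, hub, rot300W_rotW (mem_triPolygonReps.1 hω).1]
  have e2 : unroot n (rot300W υ, r', b') = ω' := by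
    rw [← rot300W_unroot hυs, hub', rot300W_rotW (mem_triPolygonReps.1 hω').1]
  -- canonicalise `rot300W υ`
  obtain ⟨ζ₀, hζ₀, r₀, hr₀, b₀, h0⟩ := exists_canon hn hζl
  obtain ⟨r₁, hr₁, b₁, h1⟩ := unroot_unroot (ζ := ζ₀) hr₀ hr b₀ b
  obtain ⟨r₂, hr₂, b₂, h2⟩ := unroot_unroot (ζ := ζ₀) hr₀ hr' b₀ b'
  rw [h0] at h1 h2
  have hω1 : ζ₀ = ω := eq_of_unroot_eq hn hω hζ₀ hr₁ (h1 ▸ e1)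
  have hω2 : ζ₀ = ω' := eq_of_unroot_eq hn hω' hζ₀ hr₂ (h2 ▸ e2)
  rw [← hω1, ← hω2]

end Canon

/-! ### The axial counts of a re-rooted / rotated / canonicalised walk -/

section Counts

variable {n : ℕ} {ω : ℕ → Site 2}

/-- Re-rooting permutes the times `[0,n]`: `image (addc r) = range`. [folklore] -/
private theorem image_addc {r : ℕ} (hr : r ≤ n) : (range (n + 1)).image (addc n r) = range (n + 1) := by
  classical
  apply Finset.eq_of_subset_of_card_le
  · intro j hj
    rw [Finset.mem_image] at hj
    obtain ⟨i, hi, rfl⟩ := hj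
    rw [Finset.mem_range] at hi ⊢
    have := addc_le' hr (show i ≤ n by omega); omega
  · rw [Finset.card_image_of_injOn, Finset.card_range]
    intro i hi j hj h
    rw [Finset.mem_coe, Finset.mem_range] at hi hj
    unfold addc at h; split_ifs at h <;> omega

/-- `image (subc r) = range`. [folklore] -/
private theorem image_subc {r : ℕ} (hr : r ≤ n) : (range (n + 1)).image (subc n r) = range (n + 1) := by
  classical
  apply Finset.eq_of_subset_of_card_le
  · intro j hj
    rw [Finset.mem_image] at hj
    obtain ⟨i, hi, rfl⟩ := hj
    rw [Finset.mem_range] at hi ⊢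
    have := subc_le' hr (show i ≤ n by omega); omega
  · rw [Finset.card_image_of_injOn, Finset.card_range]
    intro i hi j hj h
    rw [Finset.mem_coe, Finset.mem_range] at hi hj
    unfold subc at h; split_ifs at h <;> omega

/-- A generic image identity: the values of `φ ∘ (re-rooted walk)` on `[0,n]` are those of `φ (ω · − ω r)`.
[folklore] -/
private theorem image_unroot (φ : Site 2 → ℤ) {r : ℕ} (hr : r ≤ n) (b : Bool) :
    (range (n + 1)).image (fun i => φ (unroot n (ω, r, b) i)) = (range (n + 1)).image (fun i => φ (ω i - ω r)) := by
  classical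
  unfold unroot
  cases b
  · simp only [Bool.false_eq_true, if_false]
    have h1 : (fun i => φ (rotF n ω r i)) = fun i => φ (ω (addc n r (min i n)) - ω r) := rfl
    rw [h1]
    have h2 : (range (n + 1)).image (fun i => φ (ω (addc n r (min i n)) - ω r)) =
        (range (n + 1)).image ((fun j => φ (ω j - ω r)) ∘ addc n r) := by
      apply Finset.image_congr
      intro i hi
      rw [Finset.mem_coe, Finset.mem_range] at hi
      simp [min_eq_left (show i ≤ n by omega)]
    rw [h2, ← Finset.image_image, image_addc hr]
  · simp only [if_true]
    have h1 : (fun i => φ (rotB n ω r i)) = fun i => φ (ω (subc n r (min i n)) - ω r) := rfl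
    rw [h1]
    have h2 : (range (n + 1)).image (fun i => φ (ω (subc n r (min i n)) - ω r)) =
        (range (n + 1)).image ((fun j => φ (ω j - ω r)) ∘ subc n r) := by
      apply Finset.image_congr
      intro i hi
      rw [Finset.mem_coe, Finset.mem_range] at hi
      simp [min_eq_left (show i ≤ n by omega)]
    rw [h2, ← Finset.image_image, image_subc hr]

/-- **Re-rooting does not change the axial counts.** [cite: Madras1995LatticeAnimalsExponent, §2 (height/width of a polygon are class functions)] -/
theorem counts_unroot {r : ℕ} (hr : r ≤ n) (b : Bool) :
    rowCount n (unroot n (ω, r, b)) = rowCount n ω ∧ sumCount n (unroot n (ω, r, b)) = sumCount n ω ∧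
      difCount n (unroot n (ω, r, b)) = difCount n ω := by
  classical
  obtain ⟨h1, h2, h3⟩ := counts_sub_const (n := n) (ω := ω) (ω r)
  unfold rowCount sumCount difCount at *
  refine ⟨?_, ?_, ?_⟩
  · rw [show (fun i => unroot n (ω, r, b) i 1) = fun i => (fun z : Site 2 => z 1) (unroot n (ω, r, b) i) by rfl,
      image_unroot (fun z : Site 2 => z 1) hr b]
    exact h1
  · rw [show (fun i => unroot n (ω, r, b) i 0 + unroot n (ω, r, b) i 1) =
        fun i => (fun z : Site 2 => z 0 + z 1) (unroot n (ω, r, b) i) by rfl,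
      image_unroot (fun z : Site 2 => z 0 + z 1) hr b]
    exact h2
  · rw [show (fun i => unroot n (ω, r, b) i 0 - unroot n (ω, r, b) i 1) =
        fun i => (fun z : Site 2 => z 0 - z 1) (unroot n (ω, r, b) i) by rfl,
      image_unroot (fun z : Site 2 => z 0 - z 1) hr b]
    exact h3

/-- **The rotation permutes the axial counts cyclically**: `(e_Y, e_S, e_D)(ρω) = (e_S, e_D, e_Y)(ω)`.
[cite: Madras1995LatticeAnimalsExponent, §2 (the symmetry exchanging the coordinates — on 𝕋: the rotation)] -/
theorem counts_rotW (hω : ω ∈ brickSaws n) :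
    rowCount n (rotW ω) = sumCount n ω ∧ sumCount n (rotW ω) = difCount n ω ∧ difCount n (rotW ω) = rowCount n ω := by
  classical
  have hev := even_of_mem_brickSaws hω
  unfold rowCount sumCount difCount rotW
  refine ⟨?_, ?_, ?_⟩
  · -- `Y' = (X+Y)/2`: halving is injective on even numbers
    rw [show (fun i => rot60 (ω i) 1) = (fun t : ℤ => t / 2) ∘ (fun i => ω i 0 + ω i 1) by funext i; simp,
      ← Finset.image_image]
    apply Finset.card_image_of_injOn
    intro a ha b hb hab
    rw [Finset.mem_coe, Finset.mem_image] at ha hb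
    obtain ⟨i, -, rfl⟩ := ha
    obtain ⟨j, -, rfl⟩ := hb
    have := hev i; have := hev j
    simp only at hab
    omega
  · -- `X' + Y' = X − Y`
    congr 1
    apply Finset.image_congr
    intro i _
    have := hev i
    simp only [rot60_zero, rot60_one]
    omega
  · -- `X' − Y' = −2Y`
    rw [show (fun i => rot60 (ω i) 0 - rot60 (ω i) 1) = (fun t : ℤ => -2 * t) ∘ (fun i => ω i 1) by
      funext i; have := hev i; simp only [Function.comp, rot60_zero, rot60_one]; omega,
      ← Finset.image_image]
    exact Finset.card_image_of_injective _ (fun a b h => by simpa using h)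

/-- The axial counts of `rotClass ω` are those of `ω`, cyclically permuted. [cite: Madras1995LatticeAnimalsExponent, §2] -/
theorem counts_rotClass (hω : ω ∈ triPolygonReps n) :
    rowCount n (rotClass n ω) = sumCount n ω ∧ sumCount n (rotClass n ω) = difCount n ω ∧
      difCount n (rotClass n ω) = rowCount n ω := by
  have hn := two_le_of_mem_reps hω
  obtain ⟨hs, hc, -, -⟩ := mem_triPolygonReps.1 hω
  obtain ⟨-, r, hr, b, hub⟩ := canonOf_spec hn (rotW_mem_loops (mem_loops.2 ⟨hs, hc⟩))
  obtain ⟨c1, c2, c3⟩ := counts_unroot (ω := canonOf n (rotW ω)) hr b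
  rw [hub] at c1 c2 c3
  obtain ⟨d1, d2, d3⟩ := counts_rotW hs
  unfold rotClass
  exact ⟨c1.symm.trans d1, c2.symm.trans d2, c3.symm.trans d3⟩

end Counts

/-! ### The tall third -/

section Tall

variable {n : ℕ} {ω : ℕ → Site 2}

/-- `ω` is `Y`-tall: its number of rows is its largest axial count. [cite: Madras1995LatticeAnimalsExponent, §2 (at least as tall as wide; primary, not held by the lane); Hammond2015SAPJoining, §3.4 (arXiv v5 p. 12: "Orient φ and φ′ so that the height of each is at least its width")] -/
def IsYTall (n : ℕ) (ω : ℕ → Site 2) : Prop := sumCount n ω ≤ rowCount n ω ∧ difCount n ω ≤ rowCount n ω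
/-- `ω` is `S`-tall. [cite: Madras1995LatticeAnimalsExponent, §2] -/
def IsSTall (n : ℕ) (ω : ℕ → Site 2) : Prop := rowCount n ω ≤ sumCount n ω ∧ difCount n ω ≤ sumCount n ω
/-- `ω` is `D`-tall. [cite: Madras1995LatticeAnimalsExponent, §2] -/
def IsDTall (n : ℕ) (ω : ℕ → Site 2) : Prop := rowCount n ω ≤ difCount n ω ∧ sumCount n ω ≤ difCount n ω

/-- **A `Y`-tall `(n+1)`-gon has at least `√(n+1)` rows**: `n + 1 ≤ (rowCount ω)²`.
[cite: Hammond2015SAPJoining, Definition 4.8 (arXiv v5 p. 24: "h(φ) ≥ w(φ) (and thus, by a trivial argument, h(φ) ≥ n^{1/2})")]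
[cite: Madras1995LatticeAnimalsExponent, §2 (primary; not held by the lane)] -/
theorem sq_rowCount_ge (hω : ω ∈ brickSaws n) (ht : IsYTall n ω) : n + 1 ≤ rowCount n ω ^ 2 := by
  have h := succ_le_rowCount_mul_sumCount (mem_brickSaws.1 hω).2.2.2
  calc n + 1 ≤ rowCount n ω * sumCount n ω := h
    _ ≤ rowCount n ω * rowCount n ω := Nat.mul_le_mul_left _ ht.1
    _ = rowCount n ω ^ 2 := (sq _).symm

open Classical in
/-- **The tall third**: `#Q[n+1] ≤ 3 · #{ω ∈ Q[n+1] : ω is Y-tall}` — the rotation maps the `S`-tall classes injectively into the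
`Y`-tall ones and the `D`-tall classes into the `S`-tall ones, and every class is tall in some direction.
[cite: Hammond2015SAPJoining, Lemma 4.9 (arXiv v5 pp. 24–25: "|SAP^r_n| ≥ ½·|SAP_n| … brought into this set by right-angled rotation")]
[cite: Madras1995LatticeAnimalsExponent, §2 (primary; not held by the lane)] — 𝕋 edition: one third, by the 3-fold rotation —
CONSOLIDATION-BY-TRANSFER (lit-2 g16, 2026-08-23). -/
theorem card_reps_le_three_mul_tall (n : ℕ) :
    #(triPolygonReps n) ≤ 3 * #((triPolygonReps n).filter fun ω => IsYTall n ω) := by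
  classical
  set TY := (triPolygonReps n).filter fun ω => IsYTall n ω
  set TS := (triPolygonReps n).filter fun ω => IsSTall n ω
  set TD := (triPolygonReps n).filter fun ω => IsDTall n ω
  have hcover : triPolygonReps n ⊆ TY ∪ TS ∪ TD := by
    intro ω hω
    simp only [TY, TS, TD, Finset.mem_union, Finset.mem_filter]
    by_cases hY : IsYTall n ω
    · exact Or.inl (Or.inl ⟨hω, hY⟩)
    by_cases hS : IsSTall n ω
    · exact Or.inl (Or.inr ⟨hω, hS⟩)
    unfold IsYTall at hY; unfold IsSTall at hS
    refine Or.inr ⟨hω, ?_⟩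
    unfold IsDTall
    omega
  have hST : #TS ≤ #TY := by
    refine Finset.card_le_card_of_injOn (rotClass n) (fun ω hω => ?_) (fun ω hω ω' hω' h => ?_)
    · rw [Finset.mem_coe, Finset.mem_filter] at hω ⊢
      obtain ⟨c1, c2, c3⟩ := counts_rotClass hω.1
      refine ⟨rotClass_mem hω.1, ?_, ?_⟩
      · rw [c1, c2]; exact hω.2.2
      · rw [c1, c3]; exact hω.2.1
    · rw [Finset.mem_coe, Finset.mem_filter] at hω hω'
      exact rotClass_injOn (Finset.mem_coe.2 hω.1) (Finset.mem_coe.2 hω'.1) h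
  have hDS : #TD ≤ #TS := by
    refine Finset.card_le_card_of_injOn (rotClass n) (fun ω hω => ?_) (fun ω hω ω' hω' h => ?_)
    · rw [Finset.mem_coe, Finset.mem_filter] at hω ⊢
      obtain ⟨c1, c2, c3⟩ := counts_rotClass hω.1
      refine ⟨rotClass_mem hω.1, ?_, ?_⟩
      · rw [c1, c2]; exact hω.2.2
      · rw [c2, c3]; exact hω.2.1
    · rw [Finset.mem_coe, Finset.mem_filter] at hω hω'
      exact rotClass_injOn (Finset.mem_coe.2 hω.1) (Finset.mem_coe.2 hω'.1) h
  calc #(triPolygonReps n) ≤ #(TY ∪ TS ∪ TD) := Finset.card_le_card hcover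
    _ ≤ #TY + #TS + #TD := (Finset.card_union_le _ _).trans (Nat.add_le_add_right (Finset.card_union_le _ _) _)
    _ ≤ 3 * #TY := by omega

end Tall

end TriPolygon

end Literature.Probability.RandomPlanarGeometry.SAW

end
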